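import Summits.Ventures.PercRepro.Night2LocalD2FarPre

/-!
# PercRepro — three far preimages form a triangle (night-2, gen 15)

At a shadow set `S` of the (6,4) cell `|E ∖ G| = 2` (`G ∈ flatsQ M 5`), with `Zᵢ := G ∖ cl Bᵢ`, `Hᵢ := cl Bᵢ` for the far
preimages `Bᵢ` of `S` (Night2LocalD2FarPre):

* `card_union_le_three_or_nested`, `card_union_three_le_four` — finite-set combinatorics of three 2-sets.
* `exists_mem_union_of_three_far` — each far pair meets the union of any two other far pairs (from
  `not_sdiff_subset_inter_of_two_far`).
* `rkN_inter_le_two_of_nested` — if `Z₂ ∩ Z₃ ⊆ Z₁` then `ρ(H₁ ∩ H₂ ∩ H₁ ∩ H₃) ≤ 2` (submodularity on `H₁ ∩ H₂`,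
  `H₁ ∩ H₃`, whose union contains `H₁`).
* **`card_union_three_far_eq_three`** — if every `C ⊆ G` with `|C| ≤ 4` has `ρ(G ∖ C) ≥ 3`, then three distinct far
  preimages of `S` have `|Z₁ ∪ Z₂ ∪ Z₃| = 3`: a series TRIANGLE.  (Otherwise the union has four elements and some
  `Zⱼ ∩ Zₖ ⊆ Zᵢ`, giving `ρ(G ∖ (Z₁ ∪ Z₂ ∪ Z₃)) ≤ 2`.)
-/

namespace PercRepro.Shadow

open Finset PerFlat ThmH

variable {α : Type*} [DecidableEq α] {M : Matroid α} [M.Finite]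

/-! ## Three far preimages -/

/-- Three 2-sets whose union has more than three elements are «nested»: some `Zⱼ ∩ Zₖ ⊆ Zᵢ`. -/
theorem card_union_le_three_or_nested {Z₁ Z₂ Z₃ : Finset α} (h₁ : Z₁.card = 2) (h₂ : Z₂.card = 2)
    (h₃ : Z₃.card = 2) :
    (Z₁ ∪ Z₂ ∪ Z₃).card ≤ 3 ∨ Z₂ ∩ Z₃ ⊆ Z₁ ∨ Z₁ ∩ Z₃ ⊆ Z₂ ∨ Z₁ ∩ Z₂ ⊆ Z₃ := by
  by_contra hcon
  push Not at hcon
  obtain ⟨hc, hn₁, hn₂, hn₃⟩ := hcon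
  obtain ⟨v, hv, hv₁⟩ := Finset.not_subset.1 hn₁
  obtain ⟨u, hu, hu₂⟩ := Finset.not_subset.1 hn₂
  obtain ⟨w, hw, hw₃⟩ := Finset.not_subset.1 hn₃
  rw [Finset.mem_inter] at hv hu hw
  have hwu : w ≠ u := fun h => hw₃ (h ▸ hu.2)
  have hwv : w ≠ v := fun h => hv₁ (h ▸ hw.1)
  have huv : u ≠ v := fun h => hu₂ (h ▸ hv.1)
  have e₁ : Z₁ = {w, u} := by
    symm
    apply Finset.eq_of_subset_of_card_le
    · intro e he
      rw [Finset.mem_insert, Finset.mem_singleton] at he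
      rcases he with rfl | rfl
      · exact hw.1
      · exact hu.1
    · rw [h₁, Finset.card_pair hwu]
  have e₂ : Z₂ = {w, v} := by
    symm
    apply Finset.eq_of_subset_of_card_le
    · intro e he
      rw [Finset.mem_insert, Finset.mem_singleton] at he
      rcases he with rfl | rfl
      · exact hw.2
      · exact hv.1
    · rw [h₂, Finset.card_pair hwv]
  have e₃ : Z₃ = {u, v} := by
    symm
    apply Finset.eq_of_subset_of_card_le
    · intro e he
      rw [Finset.mem_insert, Finset.mem_singleton] at he
      rcases he with rfl | rfl
      · exact hu.2
      · exact hv.2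
    · rw [h₃, Finset.card_pair huv]
  apply absurd hc
  push Not
  have hsub : Z₁ ∪ Z₂ ∪ Z₃ ⊆ {w, u, v} := by
    rw [e₁, e₂, e₃]
    intro e he
    simp only [Finset.mem_union, Finset.mem_insert, Finset.mem_singleton] at he ⊢
    tauto
  exact (Finset.card_le_card hsub).trans Finset.card_le_three

/-- Three distinct 2-sets, each meeting the union of the other two, have a union of at most four elements. -/
theorem card_union_three_le_four {Z₁ Z₂ Z₃ : Finset α} (h₁ : Z₁.card = 2) (h₂ : Z₂.card = 2) (h₃ : Z₃.card = 2)
    (m₁ : ∃ e ∈ Z₁, e ∈ Z₂ ∪ Z₃) (m₂ : ∃ e ∈ Z₂, e ∈ Z₁ ∪ Z₃) (m₃ : ∃ e ∈ Z₃, e ∈ Z₁ ∪ Z₂) :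
    (Z₁ ∪ Z₂ ∪ Z₃).card ≤ 4 := by
  have hsplit : (Z₁ ∪ Z₂ ∪ Z₃).card = (Z₃ \ (Z₁ ∪ Z₂)).card + (Z₁ ∪ Z₂).card := by
    rw [Finset.card_sdiff_add_card, Finset.union_comm]
  have h12 : (Z₁ ∪ Z₂).card + (Z₁ ∩ Z₂).card = 4 := by
    rw [Finset.card_union_add_card_inter, h₁, h₂]
  by_cases hdisj : (Z₁ ∩ Z₂).Nonempty
  · -- `|Z₁ ∪ Z₂| ≤ 3` and `Z₃` loses at least one element to it
    have hpos := Finset.card_pos.2 hdisj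
    obtain ⟨e, he, he'⟩ := m₃
    have hlt : (Z₃ \ (Z₁ ∪ Z₂)).card < Z₃.card := by
      apply Finset.card_lt_card
      rw [Finset.ssubset_iff_of_subset Finset.sdiff_subset]
      exact ⟨e, he, fun h => (Finset.mem_sdiff.1 h).2 he'⟩
    omega
  · -- `Z₁ ∩ Z₂ = ∅`: `Z₃` meets both, so `Z₃ ⊆ Z₁ ∪ Z₂`
    rw [Finset.not_nonempty_iff_eq_empty] at hdisj
    have hc0 : (Z₁ ∩ Z₂).card = 0 := by rw [hdisj]; rfl
    obtain ⟨a, ha, ha'⟩ := m₁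
    obtain ⟨b, hb, hb'⟩ := m₂
    rw [Finset.mem_union] at ha' hb'
    have ha3 : a ∈ Z₃ := by
      rcases ha' with h | h
      · exfalso
        have : a ∈ Z₁ ∩ Z₂ := Finset.mem_inter.2 ⟨ha, h⟩
        rw [hdisj] at this
        exact Finset.notMem_empty _ this
      · exact h
    have hb3 : b ∈ Z₃ := by
      rcases hb' with h | h
      · exfalso
        have : b ∈ Z₁ ∩ Z₂ := Finset.mem_inter.2 ⟨h, hb⟩
        rw [hdisj] at this
        exact Finset.notMem_empty _ this
      · exact h
    have hab : a ≠ b := by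
      rintro rfl
      have : a ∈ Z₁ ∩ Z₂ := Finset.mem_inter.2 ⟨ha, hb⟩
      rw [hdisj] at this
      exact Finset.notMem_empty _ this
    have e₃ : Z₃ = {a, b} := by
      symm
      apply Finset.eq_of_subset_of_card_le
      · intro e he
        rw [Finset.mem_insert, Finset.mem_singleton] at he
        rcases he with rfl | rfl
        · exact ha3
        · exact hb3
      · rw [h₃, Finset.card_pair hab]
    have hsub : Z₃ ⊆ Z₁ ∪ Z₂ := by
      rw [e₃]
      intro e he
      rw [Finset.mem_insert, Finset.mem_singleton] at he
      rcases he with rfl | rfl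
      · exact Finset.mem_union_left _ ha
      · exact Finset.mem_union_right _ hb
    have : Z₃ \ (Z₁ ∪ Z₂) = ∅ := Finset.sdiff_eq_empty_iff_subset.2 hsub
    rw [this, Finset.card_empty] at hsplit
    omega

open scoped Classical in
/-- A far pair `Zₖ = G ∖ cl Bₖ` meets `Zᵢ ∪ Zⱼ` for any two other distinct far preimages `Bᵢ ≠ Bⱼ` of `S`. -/
theorem exists_mem_union_of_three_far {G : Finset α} (hG : G ∈ flatsQ M (4 + 1)) (hd : (gr M \ G).card = 2)
    {S B₁ B₂ B₃ : Finset α} (h₁ : B₁ ∈ opFarPre M G S) (h₂ : B₂ ∈ opFarPre M G S) (h₃ : B₃ ∈ opFarPre M G S)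
    (h₁₂ : B₁ ≠ B₂) : ∃ e ∈ G \ clF M B₃, e ∈ (G \ clF M B₁) ∪ (G \ clF M B₂) := by
  have hns := not_sdiff_subset_inter_of_two_far hG hd h₁ h₂ h₁₂ (opFarPre_subset_pairPre G S h₃)
  rw [sdiff_eq_of_mem_opFarPre h₃] at hns
  obtain ⟨e, he, he'⟩ := Finset.not_subset.1 hns
  refine ⟨e, he, ?_⟩
  have heG : e ∈ G := (Finset.mem_sdiff.1 he).1
  rw [Finset.mem_inter] at he'
  rw [Finset.mem_union, Finset.mem_sdiff, Finset.mem_sdiff]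
  tauto

open scoped Classical in
/-- `G ∖ (Z₁ ∪ Z₂ ∪ Z₃) ⊆ Hᵢ` for each far preimage (`Hᵢ = cl Bᵢ`, `Zᵢ = G ∖ Hᵢ`). -/
theorem sdiff_union_subset_clF {G : Finset α} {B B₁ B₂ B₃ : Finset α}
    (h : G \ clF M B ⊆ (G \ clF M B₁) ∪ (G \ clF M B₂) ∪ (G \ clF M B₃)) :
    G \ ((G \ clF M B₁) ∪ (G \ clF M B₂) ∪ (G \ clF M B₃)) ⊆ clF M B := by
  intro e he
  rw [Finset.mem_sdiff] at he
  by_contra hecl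
  exact he.2 (h (Finset.mem_sdiff.2 ⟨he.1, hecl⟩))

open scoped Classical in
/-- The nested case: if `Z₂ ∩ Z₃ ⊆ Z₁` for three distinct far preimages, then `ρ(H₁ ∩ H₂ ∩ H₁ ∩ H₃) ≤ 2`. -/
theorem rkN_inter_le_two_of_nested {G : Finset α} (hG : G ∈ flatsQ M (4 + 1))
    {S B₁ B₂ B₃ : Finset α} (h₁ : B₁ ∈ opFarPre M G S) (h₂ : B₂ ∈ opFarPre M G S) (h₃ : B₃ ∈ opFarPre M G S)
    (h₁₂ : B₁ ≠ B₂) (h₁₃ : B₁ ≠ B₃) (hn : (G \ clF M B₂) ∩ (G \ clF M B₃) ⊆ G \ clF M B₁) :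
    rkN M ((clF M B₁ ∩ clF M B₂) ∩ (clF M B₁ ∩ clF M B₃)) ≤ 2 := by
  have hU₁ : B₁ ∈ Uq M (4 + 2) 4 := (mem_membersIn.1 (mem_opFarPre.1 h₁).1).1
  have hcl₁ : clF M B₁ ⊆ G := (mem_membersIn.1 (mem_opFarPre.1 h₁).1).2
  have hX := rkN_inter_clF_le_three_of_opFarPre hG h₁ h₂ h₁₂
  have hY := rkN_inter_clF_le_three_of_opFarPre hG h₁ h₃ h₁₃
  have hsub : clF M B₁ ⊆ (clF M B₁ ∩ clF M B₂) ∪ (clF M B₁ ∩ clF M B₃) := by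
    intro e he
    have heG : e ∈ G := hcl₁ he
    rw [Finset.mem_union, Finset.mem_inter, Finset.mem_inter]
    by_cases he₂ : e ∈ clF M B₂
    · left; exact ⟨he, he₂⟩
    · right
      refine ⟨he, ?_⟩
      by_contra he₃
      have : e ∈ G \ clF M B₁ := hn (Finset.mem_inter.2 ⟨Finset.mem_sdiff.2 ⟨heG, he₂⟩, Finset.mem_sdiff.2 ⟨heG, he₃⟩⟩)
      exact (Finset.mem_sdiff.1 this).2 he
  have hr₁ := rkN_clF_eq_of_mem_Uq hU₁
  have hU := rkN_mono (M := M) hsub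
  have hsm := rkN_submod (M := M) (clF M B₁ ∩ clF M B₂) (clF M B₁ ∩ clF M B₃)
  omega

open scoped Classical in
/-- **Three far preimages form a triangle.**  If every `C ⊆ G` with `|C| ≤ 4` has `ρ(G ∖ C) ≥ 3`, then three
distinct far preimages `B₁, B₂, B₃` of `S` have `|Z₁ ∪ Z₂ ∪ Z₃| = 3`. -/
theorem card_union_three_far_eq_three {G : Finset α} (hG : G ∈ flatsQ M (4 + 1)) (hd : (gr M \ G).card = 2)
    (h4 : ∀ C ⊆ G, C.card ≤ 4 → 3 ≤ rkN M (G \ C))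
    {S B₁ B₂ B₃ : Finset α} (h₁ : B₁ ∈ opFarPre M G S) (h₂ : B₂ ∈ opFarPre M G S) (h₃ : B₃ ∈ opFarPre M G S)
    (h₁₂ : B₁ ≠ B₂) (h₁₃ : B₁ ≠ B₃) (h₂₃ : B₂ ≠ B₃) :
    ((G \ clF M B₁) ∪ (G \ clF M B₂) ∪ (G \ clF M B₃)).card = 3 := by
  have hc₁ := (mem_opFarPre.1 h₁).2.1
  have hc₂ := (mem_opFarPre.1 h₂).2.1
  have hc₃ := (mem_opFarPre.1 h₃).2.1
  have m₃ := exists_mem_union_of_three_far hG hd h₁ h₂ h₃ h₁₂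
  have m₁ := exists_mem_union_of_three_far hG hd h₂ h₃ h₁ h₂₃
  have m₂ := exists_mem_union_of_three_far hG hd h₁ h₃ h₂ h₁₃
  have m₁' : ∃ e ∈ G \ clF M B₁, e ∈ (G \ clF M B₂) ∪ (G \ clF M B₃) := m₁
  have m₂' : ∃ e ∈ G \ clF M B₂, e ∈ (G \ clF M B₁) ∪ (G \ clF M B₃) := m₂
  have hle4 := card_union_three_le_four hc₁ hc₂ hc₃ m₁' m₂' m₃
  -- `|Z₁ ∪ Z₂| ≥ 3`
  have hZne := sdiff_clF_ne_of_opFarPre h₁ h₂ h₁₂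
  have h12 : ((G \ clF M B₁) ∪ (G \ clF M B₂)).card + ((G \ clF M B₁) ∩ (G \ clF M B₂)).card = 4 := by
    rw [Finset.card_union_add_card_inter, hc₁, hc₂]
  have hint : ((G \ clF M B₁) ∩ (G \ clF M B₂)).card ≤ 1 := by
    by_contra hcon
    push Not at hcon
    have e₁ : (G \ clF M B₁) ∩ (G \ clF M B₂) = G \ clF M B₁ :=
      Finset.eq_of_subset_of_card_le Finset.inter_subset_left (by omega)
    have e₂ : (G \ clF M B₁) ∩ (G \ clF M B₂) = G \ clF M B₂ :=
      Finset.eq_of_subset_of_card_le Finset.inter_subset_right (by omega)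
    exact hZne (e₁.symm.trans e₂)
  have hge3 : 3 ≤ ((G \ clF M B₁) ∪ (G \ clF M B₂) ∪ (G \ clF M B₃)).card := by
    have := Finset.card_le_card (Finset.subset_union_left : (G \ clF M B₁) ∪ (G \ clF M B₂) ⊆
      (G \ clF M B₁) ∪ (G \ clF M B₂) ∪ (G \ clF M B₃))
    omega
  -- the nested alternatives contradict `h4`
  have hCG : (G \ clF M B₁) ∪ (G \ clF M B₂) ∪ (G \ clF M B₃) ⊆ G := by
    intro e he
    simp only [Finset.mem_union, Finset.mem_sdiff] at he
    tauto
  have hbad : ¬ rkN M (G \ ((G \ clF M B₁) ∪ (G \ clF M B₂) ∪ (G \ clF M B₃))) ≤ 2 := by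
    have := h4 _ hCG hle4
    omega
  rcases card_union_le_three_or_nested hc₁ hc₂ hc₃ with hc | hn | hn | hn
  · omega
  · exfalso
    apply hbad
    have hsub : G \ ((G \ clF M B₁) ∪ (G \ clF M B₂) ∪ (G \ clF M B₃)) ⊆
        (clF M B₁ ∩ clF M B₂) ∩ (clF M B₁ ∩ clF M B₃) := by
      intro e he
      have hA := sdiff_union_subset_clF (M := M) (B := B₁) (Finset.subset_union_left.trans Finset.subset_union_left) he
      have hB := sdiff_union_subset_clF (M := M) (B := B₂) (Finset.subset_union_right.trans Finset.subset_union_left) he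
      have hC := sdiff_union_subset_clF (M := M) (B := B₃) Finset.subset_union_right he
      simp only [Finset.mem_inter]
      exact ⟨⟨hA, hB⟩, hA, hC⟩
    exact (rkN_mono (M := M) hsub).trans (rkN_inter_le_two_of_nested hG h₁ h₂ h₃ h₁₂ h₁₃ hn)
  · exfalso
    apply hbad
    have hsub : G \ ((G \ clF M B₁) ∪ (G \ clF M B₂) ∪ (G \ clF M B₃)) ⊆
        (clF M B₂ ∩ clF M B₁) ∩ (clF M B₂ ∩ clF M B₃) := by
      intro e he
      have hA := sdiff_union_subset_clF (M := M) (B := B₁) (Finset.subset_union_left.trans Finset.subset_union_left) he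
      have hB := sdiff_union_subset_clF (M := M) (B := B₂) (Finset.subset_union_right.trans Finset.subset_union_left) he
      have hC := sdiff_union_subset_clF (M := M) (B := B₃) Finset.subset_union_right he
      simp only [Finset.mem_inter]
      exact ⟨⟨hB, hA⟩, hB, hC⟩
    exact (rkN_mono (M := M) hsub).trans (rkN_inter_le_two_of_nested hG h₂ h₁ h₃ h₁₂.symm h₂₃ hn)
  · exfalso
    apply hbad
    have hsub : G \ ((G \ clF M B₁) ∪ (G \ clF M B₂) ∪ (G \ clF M B₃)) ⊆
        (clF M B₃ ∩ clF M B₁) ∩ (clF M B₃ ∩ clF M B₂) := by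
      intro e he
      have hA := sdiff_union_subset_clF (M := M) (B := B₁) (Finset.subset_union_left.trans Finset.subset_union_left) he
      have hB := sdiff_union_subset_clF (M := M) (B := B₂) (Finset.subset_union_right.trans Finset.subset_union_left) he
      have hC := sdiff_union_subset_clF (M := M) (B := B₃) Finset.subset_union_right he
      simp only [Finset.mem_inter]
      exact ⟨⟨hC, hA⟩, hC, hB⟩
    exact (rkN_mono (M := M) hsub).trans (rkN_inter_le_two_of_nested hG h₃ h₁ h₂ h₁₃.symm h₂₃.symm hn)

end PercRepro.Shadow
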